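import Summits.HodgeConjecture.HodgeConjecture.Theorems.HeckePrymWeilHeckePrymAnchorsCMAnchorDivisors
import HarnessLib

/-!
# The Weil line at the diagonal CM point is algebraic (item stmt-HodgeConjecture-14496, route HeckePrymWeil)

Line `Sketch`, continuation lead c34 — second half of the KEY LEMMA of the Riemann-free closure of the
crux (sequel of `…CMAnchorDivisors`). In the setting of that file — `(Y, Ψ)` a complex abelian
`2k`-fold with `Ψ ≫ Ψ = -p`, `Pr` an idempotent of `H¹(Y(ℂ); ℂ)` over `ℚ` commuting with `Ψ^*`,
CM condition `im Pr ∩ V₊ ⊆ H^{0,1}`, `ker Pr ∩ V₊ ⊆ H^{1,0}` on `V₊ = ker(Ψ^* - i√p)` — and with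
`(Y, Ψ)` balanced (`dim V₊ ∩ H^{1,0} = k`, Deligne's Prop. 4.4):

* `cm_cupPowOne_mem_algebraicClasses` — a product `w₀ ∪ ⋯ ∪ w_{2j-1}` of degree-one classes whose
  consecutive pairs `w_{2i} ∪ w_{2i+1}` are algebraic is algebraic (associativity, graded
  commutativity, and Kleiman moving by translations on an abelian variety,
  `AbelianVariety.cupProduct_mem_algebraicClasses_one`);
* `cm_finrank_pieces` — `V₊ = A ⊕ C`, `A = im Pr ∩ V₊`, `C = ker Pr ∩ V₊ = V₊ ∩ H^{1,0}`, both of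
  dimension `k`;
* `cm_weilClassesOf_le_algebraicClasses` — **the strong Weil plane of `(Y, Ψ)` is algebraic**: for
  bases `(aᵢ)` of `A`, `(cᵢ)` of `C` the class `a₁ ∪ c₁ ∪ ⋯ ∪ a_k ∪ c_k` is a non-zero (wedge basis of
  `H^{2k} = ⋀^{2k} H¹`) algebraic class of the Weil line `E₊ = ⋀^{2k} V₊`, and one non-zero algebraic
  Weil class makes the plane algebraic (`weilClassesOf_le_algebraicClasses_of_exists_ne_zero`).

This is what Deligne's argument needs at the special fibre of the Weil family ([Deligne1982HodgeCycles],
proof of Thm. 4.8 (b) with Lemma 4.5: the Weil classes of `A₀ ⊗ E` are algebraic), obtained here on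
ANY fibre whose period point is the rational diagonal CM point, from Lefschetz `(1,1)` on that fibre —
without Riemann's theorem / fullness, i.e. without identifying the fibre with a tensor point up to
isogeny. No definition, no `sorry`, no named fact taken as hypothesis.
-/

noncomputable section

-- every declaration of this problem lives in `Summit.HodgeConjecture.HodgeConjecture.…` (summit = sub-problem)
set_option linter.dupNamespace false

open CategoryTheory AlgebraicGeometry Limits
open Literature.AlgebraicTopology.SingularHomology

namespace Summit.HodgeConjecture.HodgeConjecture.Theorems.HeckePrymWeilLine

open Literature.AlgebraicGeometry Literature.AlgebraicGeometry.Motives Literature.AlgebraicGeometry.HodgeTheory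

variable {p k : ℕ} {Y : AbelianVariety ℂ} {Ψ : Y ⟶ Y}

/-- **Products of pairwise-algebraic degree-one classes are algebraic on an abelian variety.** If
`w₀, …, w_{2j-1} ∈ H¹(Y(ℂ); ℂ)` (`j ≥ 1`) are such that each `w_{2i} ∪ w_{2i+1}` is algebraic, then
`w₀ ∪ w₁ ∪ ⋯ ∪ w_{2j-1} ∈ algebraicClasses Y.X j`: by associativity and graded commutativity
`w₀ ∪ (w₁ ∪ R) = R ∪ (w₀ ∪ w₁)` with `R = w₂ ∪ ⋯ ∪ w_{2j-1}` algebraic by induction, and on an abelian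
variety the cup product of an algebraic class with a divisor class is algebraic (Kleiman moving by
translations, the tree's `AbelianVariety.cupProduct_mem_algebraicClasses_one`).
[cite: VoisinHodgeII2003, §9.2.4 Prop. 9.20] [cite: Kleiman1974Transversality, Thm. 2] -/
theorem cm_cupPowOne_mem_algebraicClasses (Y : AbelianVariety ℂ) :
    ∀ j : ℕ, 1 ≤ j → ∀ w : Fin (2 * j) → complexBetti Y.X 1,
      (∀ (i : ℕ) (hi : i + 1 < 2 * j), i % 2 = 0 →
        cupProduct (show 1 + 1 = 2 * 1 by rfl) (w ⟨i, by omega⟩) (w ⟨i + 1, hi⟩) ∈ algebraicClasses Y.X 1) →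
      cupPowOne ℂ (ComplexPoints Y.X) (2 * j) w ∈ algebraicClasses Y.X j := by
  have h11 : 1 + 1 = 2 * 1 := rfl
  intro j hj
  induction j, hj using Nat.le_induction with
  | base =>
    intro w hw
    have h := hw 0 (by norm_num) rfl
    change cupPowOne ℂ (ComplexPoints Y.X) (1 + 1) w ∈ algebraicClasses Y.X 1
    rw [cupPowOne_succ, cupPowOne_one]
    exact h
  | succ j hj ih =>
    intro w hw
    have hm : 2 * 1 + 2 * j = 2 * j + 1 + 1 := by ring
    have hm' : 2 * j + 2 * 1 = 2 * j + 1 + 1 := by ring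
    -- the tail product is algebraic by induction
    have hR : cupPowOne ℂ (ComplexPoints Y.X) (2 * j) (Fin.tail (n := 2 * j) (Fin.tail (n := 2 * j + 1) w)) ∈
        algebraicClasses Y.X j := by
      refine ih (Fin.tail (n := 2 * j) (Fin.tail (n := 2 * j + 1) w)) fun i hi hi2 => ?_
      have h := hw (i + 2) (by omega) (by omega)
      have e₁ : Fin.tail (n := 2 * j) (Fin.tail (n := 2 * j + 1) w) ⟨i, by omega⟩ = w ⟨i + 2, by omega⟩ := rfl
      have e₂ : Fin.tail (n := 2 * j) (Fin.tail (n := 2 * j + 1) w) ⟨i + 1, hi⟩ = w ⟨i + 2 + 1, by omega⟩ := rfl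
      rw [e₁, e₂]
      exact h
    -- the head pair is a divisor class
    have hd : cupProduct h11 (w 0) (Fin.tail w 0) ∈ algebraicClasses Y.X 1 := hw 0 (by omega) rfl
    change cupPowOne ℂ (ComplexPoints Y.X) (2 * j + 1 + 1) w ∈ algebraicClasses Y.X (j + 1)
    rw [cupPowOne_succ, cupPowOne_succ,
      ← cupProduct_assoc h11 (Nat.add_comm 1 (2 * j)) hm (Nat.add_comm 1 (2 * j + 1)),
      cupProduct_gradedComm_holds ℂ _ hm hm']
    have hsign : ((-1 : ℂ) ^ (2 * 1 * (2 * j))) = 1 := by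
      rw [pow_mul, pow_mul, neg_one_sq, one_pow, one_pow]
    rw [hsign, one_smul]
    exact HodgeTheory.AbelianVariety.cupProduct_mem_algebraicClasses_one Y hR hd

/-- **Dimensions at the CM point.** With `A = im Pr ∩ V₊` and `C = ker Pr ∩ V₊`: `C = V₊ ∩ H^{1,0}`
(so `dim C = k` by balancedness), `A ∩ C = 0`, `A + C = V₊` (so `dim A = k`, as `dim V₊ = 2k`).
[cite: vanGeemen1994HodgeAV, 5.7 and Lemma 5.2 (5)] [cite: Deligne1982HodgeCycles, Prop. 4.4] -/
theorem cm_finrank_pieces (hp : 0 < p) (hY : Y.dim = 2 * k) (hΨ : Ψ ≫ Ψ = -(p • 𝟙 Y))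
    (Pr : complexBetti Y.X 1 →ₗ[ℂ] complexBetti Y.X 1) (hPr : IsIdempotentElem Pr)
    (hPrT : Pr ∘ₗ (complexBetti.map Ψ.hom.hom.hom 1).hom = (complexBetti.map Ψ.hom.hom.hom 1).hom ∘ₗ Pr)
    (hrange : LinearMap.range Pr ⊓
      Module.End.eigenspace (complexBetti.map Ψ.hom.hom.hom 1).hom (Complex.I * (Real.sqrt p : ℂ)) ≤
      hodgeZeroOne (Motives.isSmoothProjective_of_dim_eq' hY))
    (hker : LinearMap.ker Pr ⊓
      Module.End.eigenspace (complexBetti.map Ψ.hom.hom.hom 1).hom (Complex.I * (Real.sqrt p : ℂ)) ≤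
      hodgeOneZero (Motives.isSmoothProjective_of_dim_eq' hY))
    (hbal : Module.finrank ℂ ↥(Module.End.eigenspace (complexBetti.map Ψ.hom.hom.hom 1).hom
      (Complex.I * (Real.sqrt p : ℂ)) ⊓ hodgeOneZero (Motives.isSmoothProjective_of_dim_eq' hY)) = k) :
    Module.finrank ℂ ↥(LinearMap.range Pr ⊓
        Module.End.eigenspace (complexBetti.map Ψ.hom.hom.hom 1).hom (Complex.I * (Real.sqrt p : ℂ))) = k ∧
      Module.finrank ℂ ↥(LinearMap.ker Pr ⊓
        Module.End.eigenspace (complexBetti.map Ψ.hom.hom.hom 1).hom (Complex.I * (Real.sqrt p : ℂ))) = k ∧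
      (LinearMap.range Pr ⊓
        Module.End.eigenspace (complexBetti.map Ψ.hom.hom.hom 1).hom (Complex.I * (Real.sqrt p : ℂ))) ⊓
        (LinearMap.ker Pr ⊓
          Module.End.eigenspace (complexBetti.map Ψ.hom.hom.hom 1).hom (Complex.I * (Real.sqrt p : ℂ))) = ⊥ ∧
      (LinearMap.range Pr ⊓
        Module.End.eigenspace (complexBetti.map Ψ.hom.hom.hom 1).hom (Complex.I * (Real.sqrt p : ℂ))) ⊔
        (LinearMap.ker Pr ⊓
          Module.End.eigenspace (complexBetti.map Ψ.hom.hom.hom 1).hom (Complex.I * (Real.sqrt p : ℂ))) =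
        Module.End.eigenspace (complexBetti.map Ψ.hom.hom.hom 1).hom (Complex.I * (Real.sqrt p : ℂ)) := by
  have hX := Motives.isSmoothProjective_of_dim_eq' hY
  haveI := finite_complexBetti_abelianVariety Y 1
  set T := (complexBetti.map Ψ.hom.hom.hom 1).hom with hT
  set μ : ℂ := Complex.I * (Real.sqrt p : ℂ) with hμ
  set V := Module.End.eigenspace T μ with hV
  set A := LinearMap.range Pr ⊓ V with hA
  set C := LinearMap.ker Pr ⊓ V with hC
  have hVdim : Module.finrank ℂ V = 2 * k := by
    have h2 := two_mul_finrank_eigenspace_eq hp hΨ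
    rw [Motives.AbelianVariety.finrank_complexBetti_one, hY] at h2
    change 2 * Module.finrank ℂ V = 2 * (2 * k) at h2
    omega
  have hPT : ∀ z, Pr (T z) = T (Pr z) := fun z => LinearMap.congr_fun hPrT z
  have hPV : ∀ z ∈ V, Pr z ∈ V := by
    intro z hz
    rw [hV, Module.End.mem_eigenspace_iff] at hz ⊢
    rw [← hPT, hz, map_smul]
  have hPP : ∀ z, Pr (Pr z) = Pr z := fun z => by rw [← Module.End.mul_apply, hPr.eq]
  -- `C = V₊ ∩ H^{1,0}`
  have hCeq : C = V ⊓ hodgeOneZero hX := by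
    apply le_antisymm
    · intro v hv
      obtain ⟨hvk, hvV⟩ := Submodule.mem_inf.1 hv
      exact Submodule.mem_inf.2 ⟨hvV, hker hv⟩
    · intro v hv
      obtain ⟨hvV, hv10⟩ := Submodule.mem_inf.1 hv
      have h1 : Pr v ∈ hodgeZeroOne hX :=
        hrange (Submodule.mem_inf.2 ⟨LinearMap.mem_range_self Pr v, hPV v hvV⟩)
      have h2 : v - Pr v ∈ hodgeOneZero hX := by
        refine hker (Submodule.mem_inf.2 ⟨?_, Submodule.sub_mem _ hvV (hPV v hvV)⟩)
        rw [LinearMap.mem_ker, map_sub, hPP, sub_self]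
      have h3 : Pr v ∈ hodgeOneZero hX := by
        have h := Submodule.sub_mem _ hv10 h2
        rwa [sub_sub_cancel] at h
      have h4 : Pr v = 0 := by
        have h := Submodule.mem_inf.2 ⟨h3, h1⟩
        rwa [hodgeOneZero_inf_hodgeZeroOne hX, Submodule.mem_bot] at h
      exact Submodule.mem_inf.2 ⟨LinearMap.mem_ker.2 h4, hvV⟩
  have hCdim : Module.finrank ℂ C = k := by rw [hCeq]; exact hbal
  -- `A ∩ C = 0`, `A + C = V₊`
  have hAC : A ⊓ C = ⊥ := by
    refine eq_bot_iff.2 fun v hv => ?_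
    obtain ⟨hvA, hvC⟩ := Submodule.mem_inf.1 hv
    have h : v ∈ LinearMap.range Pr ⊓ LinearMap.ker Pr :=
      Submodule.mem_inf.2 ⟨(Submodule.mem_inf.1 hvA).1, (Submodule.mem_inf.1 hvC).1⟩
    rwa [(LinearMap.IsIdempotentElem.isCompl hPr).inf_eq_bot] at h
  have hAC' : A ⊔ C = V := by
    apply le_antisymm (sup_le inf_le_right inf_le_right)
    intro v hvV
    have e : v = Pr v + (v - Pr v) := by rw [add_sub_cancel]
    rw [e]
    refine Submodule.add_mem_sup (Submodule.mem_inf.2 ⟨LinearMap.mem_range_self Pr v, hPV v hvV⟩)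
      (Submodule.mem_inf.2 ⟨?_, Submodule.sub_mem _ hvV (hPV v hvV)⟩)
    rw [LinearMap.mem_ker, map_sub, hPP, sub_self]
  have hAdim : Module.finrank ℂ A = k := by
    have h := Submodule.finrank_sup_add_finrank_inf_eq A C
    rw [hAC', hAC, finrank_bot, hVdim, hCdim] at h
    omega
  exact ⟨hAdim, hCdim, hAC, hAC'⟩

/-- **KEY LEMMA: at the diagonal CM point the strong Weil plane is algebraic.** Let `(Y, Ψ)` be a
complex abelian `2k`-fold with `Ψ ≫ Ψ = -p` (`p, k ≥ 1`), `Pr` an idempotent of `H¹(Y(ℂ); ℂ)` over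
`ℚ` commuting with `Ψ^*`, with the CM condition `im Pr ∩ V₊ ⊆ H^{0,1}`, `ker Pr ∩ V₊ ⊆ H^{1,0}` on
`V₊ = ker(Ψ^* - i√p)` and `(Y, Ψ)` balanced (`dim V₊ ∩ H^{1,0} = k`). Then
`weilClassesOf Y Ψ k p ≤ algebraicClasses Y.X k`. Proof: `V₊ = A ⊕ C` with `A = im Pr ∩ V₊`,
`C = ker Pr ∩ V₊` both of dimension `k` (`cm_finrank_pieces`); for bases `a₁, …, a_k` of `A` and
`c₁, …, c_k` of `C` the class `ω = a₁ ∪ c₁ ∪ a₂ ∪ c₂ ∪ ⋯ ∪ a_k ∪ c_k` is a joint eigenclass of the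
`(x·𝟙 + y·Ψ)^*` with character `(x + yi√p)^{2k}` (all factors lie in `V₊`), i.e. `ω ∈ E₊`; it is
non-zero (a wedge-basis vector of `H^{2k} = ⋀^{2k} H¹`, `hasExteriorCohomologyH1_complexPoints`);
and it is algebraic (`cm_cupPowOne_mem_algebraicClasses` with `cm_cupProduct_mem_algebraicClasses_one`).
One non-zero algebraic Weil class makes the whole plane algebraic
(`weilClassesOf_le_algebraicClasses_of_exists_ne_zero`). This replaces, for the special fibre of
Deligne's family, the identification with the tensor point `A₀ ⊗ K` up to isogeny (Riemann's
theorem) by Lefschetz `(1,1)` on the fibre itself.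
[cite: Deligne1982HodgeCycles, Lemma 4.5, Prop. 4.4 and proof of Thm. 4.8 (b), p. 50]
[cite: vanGeemen1994HodgeAV, 5.7 and proof of Thm. 6.12] -/
theorem cm_weilClassesOf_le_algebraicClasses (hp : 0 < p) (hk : 0 < k) (hY : Y.dim = 2 * k)
    (hΨ : Ψ ≫ Ψ = -(p • 𝟙 Y))
    (Pr : complexBetti Y.X 1 →ₗ[ℂ] complexBetti Y.X 1) (hPr : IsIdempotentElem Pr)
    (hPrT : Pr ∘ₗ (complexBetti.map Ψ.hom.hom.hom 1).hom = (complexBetti.map Ψ.hom.hom.hom 1).hom ∘ₗ Pr)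
    (hPrrat : ∀ x, IsRationalClass x → IsRationalClass (Pr x))
    (hrange : LinearMap.range Pr ⊓
      Module.End.eigenspace (complexBetti.map Ψ.hom.hom.hom 1).hom (Complex.I * (Real.sqrt p : ℂ)) ≤
      hodgeZeroOne (Motives.isSmoothProjective_of_dim_eq' hY))
    (hker : LinearMap.ker Pr ⊓
      Module.End.eigenspace (complexBetti.map Ψ.hom.hom.hom 1).hom (Complex.I * (Real.sqrt p : ℂ)) ≤
      hodgeOneZero (Motives.isSmoothProjective_of_dim_eq' hY))
    (hbal : Module.finrank ℂ ↥(Module.End.eigenspace (complexBetti.map Ψ.hom.hom.hom 1).hom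
      (Complex.I * (Real.sqrt p : ℂ)) ⊓ hodgeOneZero (Motives.isSmoothProjective_of_dim_eq' hY)) = k) :
    weilClassesOf Y Ψ k p ≤ algebraicClasses Y.X k := by
  classical
  haveI := finite_complexBetti_abelianVariety Y 1
  have h11 : 1 + 1 = 2 * 1 := rfl
  set T := (complexBetti.map Ψ.hom.hom.hom 1).hom with hT
  set μ : ℂ := Complex.I * (Real.sqrt p : ℂ) with hμ
  have hΛ : HasExteriorCohomologyH1 ℂ (ComplexPoints Y.X) :=
    Motives.AbelianVariety.hasExteriorCohomologyH1_complexPoints Y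
  have hb₁ : Module.finrank ℂ (complexBetti Y.X 1) = 2 * (2 * k) := by
    rw [Motives.AbelianVariety.finrank_complexBetti_one, hY]
  obtain ⟨hAdim, hCdim, hAC, hAC'⟩ := cm_finrank_pieces hp hY hΨ Pr hPr hPrT hrange hker hbal
  set V := Module.End.eigenspace T μ with hV
  set Vm := Module.End.eigenspace T (-μ) with hVm
  set A := LinearMap.range Pr ⊓ V with hA
  set C := LinearMap.ker Pr ⊓ V with hC
  have hcpl : IsCompl V Vm := isCompl_eigenspace_eigenspace_neg hp hΨ
  have hVdim : Module.finrank ℂ V = 2 * k := by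
    have h2 := two_mul_finrank_eigenspace_eq hp hΨ
    rw [hb₁] at h2
    change 2 * Module.finrank ℂ V = 2 * (2 * k) at h2
    omega
  have hVmdim : Module.finrank ℂ Vm = 2 * k := by
    rw [hVm, ← finrank_eigenspace_eq_finrank_eigenspace_neg hp hΨ]; exact hVdim
  -- bases of `A`, `C`, `V₋`, as families in `H¹`
  let bA := Module.finBasisOfFinrankEq ℂ A hAdim
  let bC := Module.finBasisOfFinrankEq ℂ C hCdim
  let bm := Module.finBasisOfFinrankEq ℂ Vm hVmdim
  let uA : Fin k → complexBetti Y.X 1 := fun i => (bA i : complexBetti Y.X 1)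
  let uC : Fin k → complexBetti Y.X 1 := fun i => (bC i : complexBetti Y.X 1)
  let um : Fin (2 * k) → complexBetti Y.X 1 := fun i => (bm i : complexBetti Y.X 1)
  have hliA : LinearIndependent ℂ uA := bA.linearIndependent.map' A.subtype A.ker_subtype
  have hliC : LinearIndependent ℂ uC := bC.linearIndependent.map' C.subtype C.ker_subtype
  have hlim : LinearIndependent ℂ um := bm.linearIndependent.map' Vm.subtype Vm.ker_subtype
  have hspA : Submodule.span ℂ (Set.range uA) = A := by
    change Submodule.span ℂ (Set.range (A.subtype ∘ bA)) = A
    rw [Set.range_comp, Submodule.span_image, bA.span_eq, Submodule.map_subtype_top]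
  have hspC : Submodule.span ℂ (Set.range uC) = C := by
    change Submodule.span ℂ (Set.range (C.subtype ∘ bC)) = C
    rw [Set.range_comp, Submodule.span_image, bC.span_eq, Submodule.map_subtype_top]
  have hspm : Submodule.span ℂ (Set.range um) = Vm := by
    change Submodule.span ℂ (Set.range (Vm.subtype ∘ bm)) = Vm
    rw [Set.range_comp, Submodule.span_image, bm.span_eq, Submodule.map_subtype_top]
  have hli₁ : LinearIndependent ℂ (Sum.elim uA uC) :=
    hliA.sum_type hliC (by rw [hspA, hspC, disjoint_iff]; exact hAC)
  have hsp₁ : Submodule.span ℂ (Set.range (Sum.elim uA uC)) = V := by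
    rw [Set.Sum.elim_range, Submodule.span_union, hspA, hspC, hAC']
  have hli : LinearIndependent ℂ (Sum.elim (Sum.elim uA uC) um) :=
    hli₁.sum_type hlim (by rw [hsp₁, hspm]; exact hcpl.disjoint)
  have hsp : ⊤ ≤ Submodule.span ℂ (Set.range (Sum.elim (Sum.elim uA uC) um)) := by
    rw [Set.Sum.elim_range, Submodule.span_union, hsp₁, hspm, hcpl.sup_eq_top]
  let B₀ := Module.Basis.mk hli hsp
  -- interleave `A` and `C`: `w = (a₁, c₁, a₂, c₂, …)` followed by the basis of `V₋`
  let eI : Fin k ⊕ Fin k ≃ Fin (2 * k) :=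
    { toFun := Sum.elim (fun i => ⟨2 * (i : ℕ), by omega⟩) (fun i => ⟨2 * (i : ℕ) + 1, by omega⟩)
      invFun := fun j => if (j : ℕ) % 2 = 0 then Sum.inl ⟨(j : ℕ) / 2, by omega⟩ else Sum.inr ⟨(j : ℕ) / 2, by omega⟩
      left_inv := by
        rintro (i | i)
        · have h : (2 * (i : ℕ)) % 2 = 0 := by omega
          simp only [Sum.elim_inl, h, ↓reduceIte, Sum.inl.injEq]
          ext; simp only; omega
        · have h : ¬ (2 * (i : ℕ) + 1) % 2 = 0 := by omega
          simp only [Sum.elim_inr, h, ↓reduceIte, Sum.inr.injEq]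
          ext; simp only; omega
      right_inv := by
        intro j
        by_cases h : (j : ℕ) % 2 = 0
        · simp only [h, ↓reduceIte, Sum.elim_inl]
          ext; simp only; omega
        · simp only [h, ↓reduceIte, Sum.elim_inr]
          ext; simp only; omega }
  let e : (Fin k ⊕ Fin k) ⊕ Fin (2 * k) ≃ Fin (2 * k + 2 * k) :=
    (Equiv.sumCongr eI (Equiv.refl (Fin (2 * k)))).trans finSumFinEquiv
  let b : Module.Basis (Fin (2 * k + 2 * k)) ℂ (complexBetti Y.X 1) := B₀.reindex e
  have hbval : ∀ j : Fin (2 * k), b (Fin.castAdd (2 * k) j) = Sum.elim uA uC (eI.symm j) := by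
    intro j
    rw [Module.Basis.reindex_apply]
    change B₀ ((Equiv.sumCongr eI (Equiv.refl (Fin (2 * k)))).symm (finSumFinEquiv.symm (Fin.castAdd (2 * k) j))) = _
    rw [finSumFinEquiv_symm_apply_castAdd, Equiv.sumCongr_symm, Equiv.sumCongr_apply, Sum.map_inl,
      Module.Basis.coe_mk, Sum.elim_inl]
  have hb_even : ∀ (i : ℕ) (hi : 2 * i < 2 * k), b (Fin.castAdd (2 * k) ⟨2 * i, hi⟩) = uA ⟨i, by omega⟩ := by
    intro i hi
    rw [hbval]
    have hsymm : eI.symm ⟨2 * i, hi⟩ = Sum.inl ⟨i, by omega⟩ := by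
      have h : (2 * i) % 2 = 0 := by omega
      change (if ((⟨2 * i, hi⟩ : Fin (2 * k)) : ℕ) % 2 = 0 then _ else _) = _
      simp only [h, ↓reduceIte, Sum.inl.injEq]
      ext; simp only; omega
    rw [hsymm, Sum.elim_inl]
  have hb_odd : ∀ (i : ℕ) (hi : 2 * i + 1 < 2 * k), b (Fin.castAdd (2 * k) ⟨2 * i + 1, hi⟩) = uC ⟨i, by omega⟩ := by
    intro i hi
    rw [hbval]
    have hsymm : eI.symm ⟨2 * i + 1, hi⟩ = Sum.inr ⟨i, by omega⟩ := by
      have h : ¬ (2 * i + 1) % 2 = 0 := by omega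
      change (if ((⟨2 * i + 1, hi⟩ : Fin (2 * k)) : ℕ) % 2 = 0 then _ else _) = _
      simp only [h, ↓reduceIte, Sum.inr.injEq]
      ext; simp only; omega
    rw [hsymm, Sum.elim_inr]
  -- the interleaved family and its product
  set w : Fin (2 * k) → complexBetti Y.X 1 := fun j => b (Fin.castAdd (2 * k) j) with hw
  have hwA : ∀ (i : ℕ) (hi : 2 * i < 2 * k), w ⟨2 * i, hi⟩ ∈ A := by
    intro i hi
    change b (Fin.castAdd (2 * k) ⟨2 * i, hi⟩) ∈ A
    rw [hb_even i hi]
    exact (bA _).2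
  have hwC : ∀ (i : ℕ) (hi : 2 * i + 1 < 2 * k), w ⟨2 * i + 1, hi⟩ ∈ C := by
    intro i hi
    change b (Fin.castAdd (2 * k) ⟨2 * i + 1, hi⟩) ∈ C
    rw [hb_odd i hi]
    exact (bC _).2
  have hwV : ∀ j, w j ∈ V := by
    intro j
    by_cases h : (j : ℕ) % 2 = 0
    · have e : j = ⟨2 * ((j : ℕ) / 2), by omega⟩ := Fin.ext (by simp only; omega)
      rw [e]
      exact (Submodule.mem_inf.1 (hwA _ (by omega))).2
    · have e : j = ⟨2 * ((j : ℕ) / 2) + 1, by omega⟩ := Fin.ext (by simp only; omega)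
      rw [e]
      exact (Submodule.mem_inf.1 (hwC _ (by omega))).2
  have hpairs : ∀ (i : ℕ) (hi : i + 1 < 2 * k), i % 2 = 0 →
      cupProduct h11 (w ⟨i, by omega⟩) (w ⟨i + 1, hi⟩) ∈ algebraicClasses Y.X 1 := by
    intro i hi hi2
    have e₁ : (⟨i, by omega⟩ : Fin (2 * k)) = ⟨2 * (i / 2), by omega⟩ := Fin.ext (by simp only; omega)
    have e₂ : (⟨i + 1, hi⟩ : Fin (2 * k)) = ⟨2 * (i / 2) + 1, by omega⟩ := Fin.ext (by simp only; omega)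
    rw [e₁, e₂]
    exact cm_cupProduct_mem_algebraicClasses_one hp hY hΨ Pr hPr hPrT hPrrat hrange hker
      (hwA _ (by omega)) (hwC _ (by omega))
  set ω := cupPowOne ℂ (ComplexPoints Y.X) (2 * k) w with hω
  have hωalg : ω ∈ algebraicClasses Y.X k := cm_cupPowOne_mem_algebraicClasses Y k hk w hpairs
  -- `ω ∈ E₊`: a joint eigenclass with character `(x + yμ)^{2k}`
  have hωW : ω ∈ weilClassesPlus Y Ψ k p := by
    rw [mem_weilClassesPlus_iff]
    intro x y
    change singularCohomology.map ℂ ℂ (Motives.AlgPoints.mapContinuous (L := ℂ) (x • 𝟙 Y + y • Ψ).hom.hom.hom)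
      (2 * k) (cupPowOne ℂ _ (2 * k) w) = _
    rw [map_cupPowOne]
    have e : (fun i => singularCohomology.map ℂ ℂ
        (Motives.AlgPoints.mapContinuous (L := ℂ) (x • 𝟙 Y + y • Ψ).hom.hom.hom) 1 (w i)) =
        fun i => ((x : ℂ) + (y : ℂ) * μ) • w i := by
      funext i
      exact complexBetti_map_nsmul_id_add_nsmul_one_of_mem_eigenspace (hwV i) x y
    rw [e, MultilinearMap.map_smul_univ, Finset.prod_const, Finset.card_univ, Fintype.card_fin, hμ,
      ← mul_assoc]
  -- `ω ≠ 0`: it is a vector of the wedge basis of `H^{2k} = ⋀^{2k} H¹`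
  have hω0 : ω ≠ 0 := by
    let Bw : Module.Basis (Set.powersetCard (Fin (2 * k + 2 * k)) (2 * k)) ℂ (complexBetti Y.X (2 * k)) :=
      (b.exteriorPower (2 * k)).map (hΛ.equiv (2 * k))
    have hBw : ω = Bw (Set.powersetCard.ofFinEmbEquiv (Fin.castAddOrderEmb (2 * k))) := by
      change _ = hΛ.equiv (2 * k) ((b.exteriorPower (2 * k)) _)
      rw [exteriorPower.basis_apply, HasExteriorCohomologyH1.equiv_apply, exteriorPower.ιMulti_family,
        wedgeToCup_ιMulti, Equiv.symm_apply_apply]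
      rfl
    rw [hBw]
    exact Bw.ne_zero _
  exact weilClassesOf_le_algebraicClasses_of_exists_ne_zero hk hp hΨ hΛ hb₁
    ⟨ω, weilClassesPlus_le_weilClassesOf Y Ψ k p hωW, hωalg, hω0⟩

/-- **The strong Weil plane at the diagonal CM point is algebraic** — `cm_weilClassesOf_le_algebraicClasses`
with every binder displayed (the registered sub-goal of line `Sketch` for this file).
[cite: Deligne1982HodgeCycles, Lemma 4.5, Prop. 4.4 and proof of Thm. 4.8 (b), p. 50]
[cite: vanGeemen1994HodgeAV, 5.7 and proof of Thm. 6.12] -/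
theorem cm_weilPlane_algebraic :
    ∀ (p k : ℕ) (Y : AbelianVariety ℂ) (Ψ : Y ⟶ Y) (hp : 0 < p) (hk : 0 < k) (hY : Y.dim = 2 * k), Ψ ≫ Ψ = -(p • 𝟙 Y) → ∀ (Pr : complexBetti Y.X 1 →ₗ[ℂ] complexBetti Y.X 1), IsIdempotentElem Pr → Pr ∘ₗ (complexBetti.map Ψ.hom.hom.hom 1).hom = (complexBetti.map Ψ.hom.hom.hom 1).hom ∘ₗ Pr → (∀ x, IsRationalClass x → IsRationalClass (Pr x)) → LinearMap.range Pr ⊓ Module.End.eigenspace (complexBetti.map Ψ.hom.hom.hom 1).hom (Complex.I * (Real.sqrt p : ℂ)) ≤ hodgeZeroOne (Motives.isSmoothProjective_of_dim_eq' hY) → LinearMap.ker Pr ⊓ Module.End.eigenspace (complexBetti.map Ψ.hom.hom.hom 1).hom (Complex.I * (Real.sqrt p : ℂ)) ≤ hodgeOneZero (Motives.isSmoothProjective_of_dim_eq' hY) → Module.finrank ℂ ↥(Module.End.eigenspace (complexBetti.map Ψ.hom.hom.hom 1).hom (Complex.I * (Real.sqrt p : ℂ)) ⊓ hodgeOneZero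 (Motives.isSmoothProjective_of_dim_eq' hY)) = k → weilClassesOf Y Ψ k p ≤ algebraicClasses Y.X k :=
  fun _ _ _ _ hp hk hY hΨ Pr hPr hPrT hPrrat hrange hker hbal =>
    cm_weilClassesOf_le_algebraicClasses hp hk hY hΨ Pr hPr hPrT hPrrat hrange hker hbal

end Summit.HodgeConjecture.HodgeConjecture.Theorems.HeckePrymWeilLine

end
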